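import Summits.BirchSwinnertonDyer.BirchSwinnertonDyer.Theorems.KatoDescentPotSupersingularWildFineSelmerFineUnitAnchor
import Summits.BirchSwinnertonDyer.BirchSwinnertonDyer.Theorems.KatoDescentTamePotSupersingularTameFineSelmerSupersingularUnitAnchor
import HarnessLib

/-!
# Route `KatoDescentTamePotSupersingular` (rung K8-t′, cell `bsd-potss`): the FINE UNIT-ANCHOR road for the
# (t′) Conj-A crux `TameFineSelmerCoatesSujatha` (item stmt-BirchSwinnertonDyer-19413) at an odd additive
# potentially-good prime `p` — twin of the K9 file `…WildFineSelmerFineUnitAnchor.lean`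
# (a `--supports … --as helper` file; seat `bsd-potss-k9-c4` g6, courtesy for `bsd-potss-k8t-c4`;
# ROUTE-FREE; nothing booked, BSD is not proved by any of this)

WHY. The congruence-anchor census of seat `bsd-potss-conjA-anchor` (FINDING-19386-19413 §1d) finds that on
the 163 rows of the (t′) crux at `p ≥ 5` the `E[p]`-congruent partners are ALL ADDITIVE at `p` (one
exception, 280525t1 ≃ 49a at `5`): every previous anchor road (good ordinary / CM / good supersingular
anchors) is void there by construction. The fine control theorem of this seat
(`FineSelmerControl.fineSelmerInfty_eq_bot_of_natCard_selmerGroupPInfty_eq_one`, p479853: Greenberg's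
Prop. 3.8 for the FINE Selmer group, reduction-type-free at every place incl. `v ∣ p`) needs no reduction
hypothesis on the anchor: `rank W′(ℚ) = 0`, `#Ш(W′/ℚ)[p^∞] = 1` and no non-zero `D_v`-fixed `p`-torsion in
`W′[p^∞]` (`W′(ℚ_v)[p] = 0`) for `v` in a finite set `S ⊇ {p} ∪ {bad places}` give `Sel₀(W′/ℚ_∞) = 0`, hence
(A) at `(W′,p)` (`WildFineSelmerFineUnitAnchor.conjA_rat_of_fineUnitData`, any `p`), hence (A) at the row
(Lim–Sujatha `hLS`), hence Upper (`TameFineSelmerSupersingularUnitAnchor.missingUpperBoundAt_addv_of_conjA`).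
At `v = p` the torsion condition is a property of the ROW (`W′[p] ≅ W[p]`).

* **`missingUpperBoundAt_addv_of_fineUnitAnchor`** — Upper at an additive potentially-good `r_an = 0` row with
  `W[p]` irreducible (`p` odd) ⟸ {`hLS`, Kato fine reading `hKatoA`, GZK, modularity} + ONE congruent
  elliptic `W′` of ANY reduction type at `p` with the fine unit data; `…_analytic` (`r_an(W′) = 0`,
  `p ∤ #Ш(W′)`); `…_smallConductor…` (`N_{W′} < 5000`, `Ш_an(W′) = m`, `p ∤ m`, bsd.S31).
* `tameFineSelmerCoatesSujatha_of_fineUnitAnchorCertificates` — the crux BODY from per-row certificates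
  (k8t-c4/k9-c4 g3's `TameFineSelmerOrdinaryAnchor.tameFineSelmerCoatesSujatha_of_mixedCertificates`).

HONEST FRAMING: conditional-results on the displayed named facts of the ROW side (all typed in the tree; no
new fact); the anchor side is the unconditional fine control theorem; the per-row data are hypotheses (census
data of record); item 19413 is NOT closed; class-wide the crux is Coates–Sujatha (A), a named open problem.
References: [GreenbergLNM1716] Prop. 3.8 (pp. 95–96); [LimSujatha2018] §3 Prop. 3.2; [Kato2004Asterisque]
Thm. 14.5 (3), Prop. 14.16 (2); [CoatesSujatha2005] §3; [CreutzMiller2012] Thm. 1.1.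
-/

set_option autoImplicit false
-- sibling precedent (`KatoDescentPotSupersingularAssembly.lean`): the directory name repeats the summit name
set_option linter.dupNamespace false

noncomputable section

open scoped Classical

universe u

namespace Summit.BirchSwinnertonDyer.BirchSwinnertonDyer.Theorems.TameFineSelmerFineUnitAnchor

open NumberField IsDedekindDomain Field
open WeierstrassCurve Literature.NumberTheory.EllipticCurves
  Literature.NumberTheory.EllipticCurves.GreenbergSelmer
  Literature.NumberTheory.EllipticCurves.IwasawaAlgebra
  Literature.NumberTheory.EllipticCurves.Rank1Residual
  Literature.NumberTheory.EllipticCurves.Rank1Residual.Typed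
  Literature.NumberTheory.EllipticCurves.ZpExtension
  Summit.BirchSwinnertonDyer.Rank1Residual Summit.BirchSwinnertonDyer.Rank1Residual.Additive
  Summit.BirchSwinnertonDyer.Rank1Residual.O6
  Summit.BirchSwinnertonDyer.BirchSwinnertonDyer.Theorems

/-- **THE FINE UNIT-ANCHOR ROAD at an additive potentially-good odd prime, row form (K8-t′ twin).** Let
`W/ℚ` be globally minimal with `r_an = 0`, `p` odd, additive potentially good at `p` (`Addv W p`,
`0 ≤ ord_p j`), `W[p]` irreducible, and `W′` an elliptic curve over `ℚ` with `W′[p] ≅ W[p]` — of ANY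
reduction type at `p` — with a finite set `S` of finite places off which `W′` is good and `v ∤ p`,
`rank W′(ℚ) = 0`, `#Ш(W′/ℚ)[p^∞] = 1`, and no non-zero `p`-torsion element of `W′[p^∞]` fixed by `D_v` for
`v ∈ S` (`W′(ℚ_v)[p] = 0`). Then `ord_p #Ш(W) ≤ ord_p #Ш_an(W)` (`MissingUpperBoundAt W p`).
[cite: GreenbergLNM1716, Prop. 3.8 (pp. 95–96)] [cite: LimSujatha2018, §3 Prop. 3.2]
[cite: Kato2004Asterisque, Thm. 14.5 (3) (p. 236) and Prop. 14.16 (2) (p. 244)] -/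
theorem missingUpperBoundAt_addv_of_fineUnitAnchor
    (hLS : LimSujatha2018.prop32_fineSelmerDual_moduleFinite_iff_of_torsionIso)
    (hKatoA :
      Kato2004.rankZero_padicValNat_sha_add_padicValNat_tamagawa_le_of_additive_potGood_of_irreducible_of_fineSelmerDual_fg)
    (hGZK : rank_eq_analyticRank_of_analyticRank_le_one) (hmod : hasEntireLFunction_rat)
    (W : WeierstrassCurve ℚ) [W.IsElliptic] [W.IsGloballyMinimal] (p : ℕ) [Fact p.Prime]
    (hr : W.analyticRank = 0) (hp : p ≠ 2) (hA : Addv W p) (hj : 0 ≤ padicValRat p W.j)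
    (hirr : W.HasIrreducibleModPGaloisRep p)
    (W' : WeierstrassCurve ℚ) [W'.IsElliptic] (hcong : ModPCongruent W' W p)
    (S : Finset (HeightOneSpectrum (𝓞 ℚ)))
    (hS : ∀ v ∉ S, ((p : ℕ) : 𝓞 ℚ) ∉ v.asIdeal ∧ W'.HasGoodReductionAt v)
    (hrank' : W'.mordellWeilRank = 0) (hsha' : Nat.card (AddCommGroup.primaryComponent W'.sha p) = 1)
    (hloc' : ∀ v ∈ S, ∀ x : W'.geomPrimaryTorsion p, p • x = 0 → (∀ d ∈ decomp v, d • x = x) → x = 0) :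
    MissingUpperBoundAt W p :=
  TameFineSelmerSupersingularUnitAnchor.missingUpperBoundAt_addv_of_conjA hKatoA hGZK hmod W p hr hp hA hj
    hirr
    (WildFineSelmerCongruenceFact.conjA_of_modPCongruent hLS hp hcong
      (WildFineSelmerFineUnitAnchor.conjA_rat_of_fineUnitData W' S hS hrank' hsha' hloc'))

/-- **The same with the anchor's global data in PRINTED form**: `r_an(W′) = 0` and `p ∤ #Ш(W′/ℚ)`.
[cite: GreenbergLNM1716, Prop. 3.8 (pp. 95–96)] [cite: LimSujatha2018, §3 Prop. 3.2] -/
theorem missingUpperBoundAt_addv_of_fineUnitAnchor_analytic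
    (hLS : LimSujatha2018.prop32_fineSelmerDual_moduleFinite_iff_of_torsionIso)
    (hKatoA :
      Kato2004.rankZero_padicValNat_sha_add_padicValNat_tamagawa_le_of_additive_potGood_of_irreducible_of_fineSelmerDual_fg)
    (hGZK : rank_eq_analyticRank_of_analyticRank_le_one) (hmod : hasEntireLFunction_rat)
    (W : WeierstrassCurve ℚ) [W.IsElliptic] [W.IsGloballyMinimal] (p : ℕ) [Fact p.Prime]
    (hr : W.analyticRank = 0) (hp : p ≠ 2) (hA : Addv W p) (hj : 0 ≤ padicValRat p W.j)
    (hirr : W.HasIrreducibleModPGaloisRep p)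
    (W' : WeierstrassCurve ℚ) [W'.IsElliptic] (hcong : ModPCongruent W' W p)
    (S : Finset (HeightOneSpectrum (𝓞 ℚ)))
    (hS : ∀ v ∉ S, ((p : ℕ) : 𝓞 ℚ) ∉ v.asIdeal ∧ W'.HasGoodReductionAt v)
    (hr' : W'.analyticRank = 0) (hsha' : ¬ p ∣ Nat.card W'.sha)
    (hloc' : ∀ v ∈ S, ∀ x : W'.geomPrimaryTorsion p, p • x = 0 → (∀ d ∈ decomp v, d • x = x) → x = 0) :
    MissingUpperBoundAt W p :=
  TameFineSelmerSupersingularUnitAnchor.missingUpperBoundAt_addv_of_conjA hKatoA hGZK hmod W p hr hp hA hj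
    hirr
    (WildFineSelmerCongruenceFact.conjA_of_modPCongruent hLS hp hcong
      (WildFineSelmerFineUnitAnchor.conjA_rat_of_analyticRankZero_of_fineUnitData hGZK W' S hS hr' hsha' hloc'))

/-- **The same with a SMALL-CONDUCTOR anchor**: `N_{W′} < 5000`, `rank W′(ℚ) = 0`, `Ш_an(W′) = m` with
`p ∤ m` — `#Ш(W′) = m` by the verified BSD formula below conductor `5000` (bsd.S31 `hS31`; `W′` globally
minimal). [cite: CreutzMiller2012, Thm. 1.1] [cite: GreenbergLNM1716, Prop. 3.8 (pp. 95–96)]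
[cite: LimSujatha2018, §3 Prop. 3.2] -/
theorem missingUpperBoundAt_addv_of_smallConductorFineUnitAnchor
    (hLS : LimSujatha2018.prop32_fineSelmerDual_moduleFinite_iff_of_torsionIso)
    (hKatoA :
      Kato2004.rankZero_padicValNat_sha_add_padicValNat_tamagawa_le_of_additive_potGood_of_irreducible_of_fineSelmerDual_fg)
    (hGZK : rank_eq_analyticRank_of_analyticRank_le_one) (hmod : hasEntireLFunction_rat)
    (hS31 : bsdTriple_of_rank_le_one_of_conductor_lt)
    (W : WeierstrassCurve ℚ) [W.IsElliptic] [W.IsGloballyMinimal] (p : ℕ) [Fact p.Prime]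
    (hr : W.analyticRank = 0) (hp : p ≠ 2) (hA : Addv W p) (hj : 0 ≤ padicValRat p W.j)
    (hirr : W.HasIrreducibleModPGaloisRep p)
    (W' : WeierstrassCurve ℚ) [W'.IsElliptic] [W'.IsGloballyMinimal] (hcong : ModPCongruent W' W p)
    (S : Finset (HeightOneSpectrum (𝓞 ℚ)))
    (hS : ∀ v ∉ S, ((p : ℕ) : 𝓞 ℚ) ∉ v.asIdeal ∧ W'.HasGoodReductionAt v)
    (hN' : W'.conductorNorm ℤ < 5000) (hrank' : W'.mordellWeilRank = 0)
    {m : ℕ} (hshaAn' : shaAn W' = (m : ℂ)) (hm : ¬ p ∣ m)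
    (hloc' : ∀ v ∈ S, ∀ x : W'.geomPrimaryTorsion p, p • x = 0 → (∀ d ∈ decomp v, d • x = x) → x = 0) :
    MissingUpperBoundAt W p := by
  obtain ⟨hfin, hcard⟩ :=
    WildFineSelmerSmallConductorAnchor.natCard_sha_eq_of_conductor_lt_of_shaAn_eq hS31 W'
      (by rw [hrank']; exact zero_le_one) hN' hshaAn'
  haveI : Finite W'.sha := hfin
  have h1 : Nat.card (AddCommGroup.primaryComponent W'.sha p) = 1 := by
    rw [card_addPrimaryComponent_eq_pow p, hcard, Nat.factorization_eq_zero_of_not_dvd hm, pow_zero]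
  exact missingUpperBoundAt_addv_of_fineUnitAnchor hLS hKatoA hGZK hmod W p hr hp hA hj hirr W' hcong S hS
    hrank' h1 hloc'

/-- **The (t′) crux body from per-row FINE unit-anchor certificates** (class form; the `hcert` currency for the
census seats): if every row of `TameFineSelmerCoatesSujatha` (item 19413) admits ONE congruent elliptic `W′/ℚ`
— any reduction type at `p` — with a finite set `S` off which `W′` is good and `v ∤ p`, `rank 0`,
`#Ш[p^∞] = 1` and no `D_v`-fixed `p`-torsion on `S`, the BODY of the route decl holds verbatim (via
`TameFineSelmerOrdinaryAnchor.tameFineSelmerCoatesSujatha_of_mixedCertificates`, its (A)-disjunct fed by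
`WildFineSelmerFineUnitAnchor.conjA_rat_of_fineUnitData`). Conditional on `hLS` only; the item is NOT closed.
[cite: LimSujatha2018, §3 Prop. 3.2] [cite: GreenbergLNM1716, Prop. 3.8 (pp. 95–96)] [cite: CoatesSujatha2005, §3] -/
theorem tameFineSelmerCoatesSujatha_of_fineUnitAnchorCertificates
    (hLS : LimSujatha2018.prop32_fineSelmerDual_moduleFinite_iff_of_torsionIso)
    (hcert : ∀ (W : WeierstrassCurve ℚ) [W.IsElliptic] [W.IsGloballyMinimal] (p : ℕ) [Fact p.Prime],
      W.analyticRank = 0 → p ≠ 2 → Addv W p → SubTprime W p → W.HasIrreducibleModPGaloisRep p →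
      ¬ (∀ n : ℕ, W.HasSurjectiveModNGaloisRep (p ^ n : ℕ)) → ¬ W.HasCM →
      ∃ (W' : WeierstrassCurve ℚ) (_ : W'.IsElliptic) (S : Finset (HeightOneSpectrum (𝓞 ℚ))),
        ModPCongruent W' W p ∧ (∀ v ∉ S, ((p : ℕ) : 𝓞 ℚ) ∉ v.asIdeal ∧ W'.HasGoodReductionAt v) ∧
        W'.mordellWeilRank = 0 ∧ Nat.card (AddCommGroup.primaryComponent W'.sha p) = 1 ∧
        (∀ v ∈ S, ∀ x : W'.geomPrimaryTorsion p, p • x = 0 → (∀ d ∈ decomp v, d • x = x) → x = 0)) :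
    ∀ (W : WeierstrassCurve ℚ) [W.IsElliptic] [W.IsGloballyMinimal] (p : ℕ) [Fact p.Prime],
      W.analyticRank = 0 → p ≠ 2 → Addv W p → SubTprime W p → W.HasIrreducibleModPGaloisRep p →
      ¬ (∀ n : ℕ, W.HasSurjectiveModNGaloisRep (p ^ n : ℕ)) → ¬ W.HasCM →
      ∀ (κ : ZpExtension ℚ p), κ.IsCyclotomic →
        ∃ (γ : absoluteGaloisGroup ℚ) (D : W.FineSelmerDualData κ γ),
          Module.Finite ℤ_[p] (RestrictScalars ℤ_[p] (IwasawaAlgebra p) D.X) := by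
  refine TameFineSelmerOrdinaryAnchor.tameFineSelmerCoatesSujatha_of_mixedCertificates hLS
    fun W _ _ p _ hr hp hA hT hirr hns hcm ↦ ?_
  obtain ⟨W', hW'e, S, hcong, hS, hrank', hsha', hloc'⟩ := hcert W p hr hp hA hT hirr hns hcm
  haveI := hW'e
  exact ⟨W', hW'e, hcong,
    Or.inl (WildFineSelmerFineUnitAnchor.conjA_rat_of_fineUnitData W' S hS hrank' hsha' hloc')⟩

end Summit.BirchSwinnertonDyer.BirchSwinnertonDyer.Theorems.TameFineSelmerFineUnitAnchor

end
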